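import Mathlib
import Summits.Ventures.HodgeRepro.Primitive
import Summits.Ventures.HodgeRepro.MTLattice
import Summits.Ventures.HodgeRepro.CMFieldGalois

/-!
# Kubota's rank of a CM type (the field-theoretic definition) equals the type-matrix rank

Blind re-derivation cell `pub-hodge-repro`, seat `typer-2`.  Mathlib only.

Printed source: Gordon, *A survey of the Hodge conjecture for abelian varieties* (arXiv alg-geom/9709030),
§9.1 Remark: "The rank of a CM-type seems to have originally been defined by Kubota [B.60], who defined it
as `dim_ℚ {∑_{φ ∈ S} φ(x) : x ∈ K}`.  The equality of this with the dimension of the Mumford–Tate group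
follows from the methods in [B.91] […]."  (Quoted from `CMRank.lean`, seat typer.)

For `K/ℚ` Galois with group `G` and `Φ ⊆ G`, Kubota's space `{∑_{g ∈ Φ} g(x) : x ∈ K}` is the range of
the `ℚ`-linear *`Φ`-trace* `tr_Φ : K → K`.  In a normal basis `{g θ}_{g ∈ G}` (`IsGalois.normalBasis`,
Mathlib) the matrix of `tr_Φ` is the matrix of LEFT multiplication by `qTypeOf Φ` on `ℚ[G]`, whereas
the type matrix of `CMRank.lean` (rows = Galois translates `g • Φ`) is the transpose of the matrix of
RIGHT multiplication by `qTypeOf Φ`.  The two multiplication matrices have the same rank (one is the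
transpose of the other up to the re-indexing `g ↦ g⁻¹`), hence

  `kubotaRank K Φ = cmRank Φ`  (`kubotaRank_eq_cmRank`).

Contents:
* `leftMulMatrix x`, `rightMulMatrix x` — matrices of `a ↦ x * a`, `a ↦ a * x` on `ℚ[G]`;
  `rank_rightMulMatrix : rank (rightMulMatrix x) = rank (leftMulMatrix x)`;
* `typeMatrix_eq_transpose_rightMulMatrix`, `cmRank_eq_rank_leftMulMatrix`;
* `traceΦ K Φ : K →ₗ[ℚ] K`, `kubotaRank K Φ := finrank ℚ (range (traceΦ K Φ))`,
  `toMatrix_normalBasis_traceΦ`, `kubotaRank_eq_cmRank`;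
* `sum_emb_eq_traceΦ`: Kubota's sum over embeddings `∑_{φ ∈ S} φ(x)` with `S = φ₀ ∘ Φ` is
  `φ₀ (tr_Φ x)` (so the dimension is the same whether computed in `ℂ` or in `K`).
-/

open Finset Matrix MonoidAlgebra
open scoped Pointwise

namespace HodgeRepro.Hecke

variable {G : Type*} [Group G] [DecidableEq G] [Fintype G]

/-! ### Multiplication matrices on `ℚ[G]` -/

/-- The matrix of left multiplication `a ↦ x * a` on `ℚ[G]` in the basis `([g])_g`: entry
`(k, h) ↦ x_{k h⁻¹}` (coefficient of `[k]` in `x * [h]`). -/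
noncomputable def leftMulMatrix (x : MonoidAlgebra ℚ G) : Matrix G G ℚ :=
  fun k h => x.coeff (k * h⁻¹)

/-- The matrix of right multiplication `a ↦ a * x` on `ℚ[G]`: entry `(k, h) ↦ x_{h⁻¹ k}`
(coefficient of `[k]` in `[h] * x`). -/
noncomputable def rightMulMatrix (x : MonoidAlgebra ℚ G) : Matrix G G ℚ :=
  fun k h => x.coeff (h⁻¹ * k)

omit [DecidableEq G] [Fintype G] in
/-- Entry of the left-multiplication matrix. -/
theorem leftMulMatrix_apply (x : MonoidAlgebra ℚ G) (k h : G) :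
    leftMulMatrix x k h = x.coeff (k * h⁻¹) := rfl

omit [DecidableEq G] [Fintype G] in
/-- Entry of the right-multiplication matrix. -/
theorem rightMulMatrix_apply (x : MonoidAlgebra ℚ G) (k h : G) :
    rightMulMatrix x k h = x.coeff (h⁻¹ * k) := rfl

omit [DecidableEq G] [Fintype G] in
/-- `rightMulMatrix x` is the transpose of `leftMulMatrix x` re-indexed by `g ↦ g⁻¹` on both sides. -/
theorem rightMulMatrix_eq_transpose (x : MonoidAlgebra ℚ G) :
    rightMulMatrix x = ((leftMulMatrix x).submatrix (Equiv.inv G) (Equiv.inv G))ᵀ := by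
  ext k h
  simp only [rightMulMatrix_apply, transpose_apply, submatrix_apply, leftMulMatrix_apply,
    Equiv.inv_apply, inv_inv]

omit [DecidableEq G] in
/-- Left and right multiplication by `x` have the same rank (`dim x·ℚ[G] = dim ℚ[G]·x`). -/
theorem rank_rightMulMatrix (x : MonoidAlgebra ℚ G) :
    (rightMulMatrix x).rank = (leftMulMatrix x).rank := by
  rw [rightMulMatrix_eq_transpose, rank_transpose, rank_submatrix]

omit [Fintype G] in
/-- The type matrix of `CMRank.lean` is the transpose of the right-multiplication matrix of
`qTypeOf Φ`: `typeMatrix Φ g h = [g⁻¹ h ∈ Φ] = (qTypeOf Φ).coeff (g⁻¹ * h)`. -/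
theorem typeMatrix_eq_transpose_rightMulMatrix (Φ : Finset G) :
    typeMatrix Φ = (rightMulMatrix (qTypeOf Φ))ᵀ := by
  ext g h
  rw [typeMatrix_apply, transpose_apply, rightMulMatrix_apply, coeff_qTypeOf]
  have h1 : h ∈ g • Φ ↔ g⁻¹ * h ∈ Φ := by rw [← inv_smul_mem_iff, smul_eq_mul]
  simp only [h1]

/-- `cmRank Φ` is the rank of left multiplication by `qTypeOf Φ` on `ℚ[G]`. -/
theorem cmRank_eq_rank_leftMulMatrix (Φ : Finset G) :
    cmRank Φ = (leftMulMatrix (qTypeOf Φ)).rank := by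
  unfold cmRank
  rw [typeMatrix_eq_transpose_rightMulMatrix, rank_transpose, rank_rightMulMatrix]

end HodgeRepro.Hecke

namespace HodgeRepro.CMGalois

open scoped Classical

variable (K : Type*) [Field K] [NumberField K] [IsGalois ℚ K]

/-! ### Kubota's rank for a Galois number field -/

/-- The `Φ`-trace `x ↦ ∑_{g ∈ Φ} g x`, a `ℚ`-linear endomorphism of `K` (`Φ ⊆ Gal(K/ℚ)`). -/
noncomputable def traceΦ (Φ : Finset (K ≃ₐ[ℚ] K)) : K →ₗ[ℚ] K :=
  ∑ g ∈ Φ, (g : K →ₐ[ℚ] K).toLinearMap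

omit [IsGalois ℚ K] in
/-- `tr_Φ x = ∑_{g ∈ Φ} g x`. -/
theorem traceΦ_apply (Φ : Finset (K ≃ₐ[ℚ] K)) (x : K) : traceΦ K Φ x = ∑ g ∈ Φ, g x := by
  unfold traceΦ
  rw [LinearMap.sum_apply]
  rfl

/-- **Kubota's rank** of `Φ ⊆ Gal(K/ℚ)`: `dim_ℚ {∑_{g ∈ Φ} g(x) : x ∈ K}` (Gordon §9.1 Remark). -/
noncomputable def kubotaRank (Φ : Finset (K ≃ₐ[ℚ] K)) : ℕ :=
  Module.finrank ℚ (LinearMap.range (traceΦ K Φ))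

/-- In the normal basis `(g θ)_{g ∈ G}` the `Φ`-trace is left multiplication by `qTypeOf Φ`. -/
theorem toMatrix_normalBasis_traceΦ (Φ : Finset (K ≃ₐ[ℚ] K)) :
    LinearMap.toMatrix (IsGalois.normalBasis ℚ K) (IsGalois.normalBasis ℚ K) (traceΦ K Φ) =
      Hecke.leftMulMatrix (Hecke.qTypeOf Φ) := by
  ext k h
  rw [LinearMap.toMatrix_apply, traceΦ_apply, Hecke.leftMulMatrix_apply, Hecke.coeff_qTypeOf]
  have hgh : ∀ g : K ≃ₐ[ℚ] K, g (IsGalois.normalBasis ℚ K h) = IsGalois.normalBasis ℚ K (g * h) := by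
    intro g
    rw [IsGalois.normalBasis_apply h, IsGalois.normalBasis_apply (g * h), AlgEquiv.mul_apply]
  simp only [hgh, map_sum, Module.Basis.repr_self, Finsupp.finsetSum_apply, Finsupp.single_apply]
  have : ∀ g : K ≃ₐ[ℚ] K, (g * h = k) ↔ (g = k * h⁻¹) := fun g => (eq_mul_inv_iff_mul_eq).symm
  simp only [this]
  exact Finset.sum_ite_eq' Φ (k * h⁻¹) (fun _ => (1 : ℚ))

/-- **Kubota's rank equals the type-matrix rank**: for `K/ℚ` Galois and `Φ ⊆ Gal(K/ℚ)`,
`dim_ℚ {∑_{g ∈ Φ} g(x) : x ∈ K} = cmRank Φ`. -/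
theorem kubotaRank_eq_cmRank (Φ : Finset (K ≃ₐ[ℚ] K)) : kubotaRank K Φ = cmRank Φ := by
  unfold kubotaRank
  have h := Matrix.rank_eq_finrank_range_toLin
    (LinearMap.toMatrix (IsGalois.normalBasis ℚ K) (IsGalois.normalBasis ℚ K) (traceΦ K Φ))
    (IsGalois.normalBasis ℚ K) (IsGalois.normalBasis ℚ K)
  rw [Matrix.toLin_toMatrix] at h
  rw [← h, toMatrix_normalBasis_traceΦ, Hecke.cmRank_eq_rank_leftMulMatrix]

/-! ### Kubota's sum over complex embeddings -/

/-- Kubota's sum `∑_{φ ∈ S} φ(x)` over the embeddings `S = {φ₀ ∘ g | g ∈ Φ}` is `φ₀ (tr_Φ x)`: the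
`ℚ`-span of these values in `ℂ` is the image of `range (tr_Φ)` under the injective `ℚ`-linear map
`φ₀`, so its dimension is `kubotaRank K Φ`. -/
theorem sum_emb_eq_traceΦ (φ₀ : K →+* ℂ) (Φ : Finset (K ≃ₐ[ℚ] K)) (x : K) :
    ∑ φ ∈ Φ.map (embEquiv K φ₀).toEmbedding, φ x = φ₀ (traceΦ K Φ x) := by
  rw [traceΦ_apply, map_sum, Finset.sum_map]
  rfl

end HodgeRepro.CMGalois

namespace HodgeRepro.Hecke

variable {G : Type*} [Group G] [DecidableEq G] [Fintype G]

/-! ### Right translates give the same rank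

If the Galois conjugates of a CM type are read as RIGHT translates `Φ τ = {φ ∘ τ}` (pre-composition
with `τ ∈ Gal(K/ℚ)`, `rmul` of `Primitive.lean`) instead of left translates, the span of their
indicator vectors has the same dimension: its matrix is the transpose of `leftMulMatrix (qTypeOf Φ)`. -/

/-- The matrix of right translates `(τ, h) ↦ [h ∈ Φ τ]`. -/
noncomputable def rtypeMatrix (Φ : Finset G) : Matrix G G ℚ := fun τ h => ind (rmul Φ τ) h

omit [Fintype G] in
/-- The right-translate matrix is the transpose of the left-multiplication matrix of `qTypeOf Φ`. -/
theorem rtypeMatrix_eq_transpose (Φ : Finset G) :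
    rtypeMatrix Φ = (leftMulMatrix (qTypeOf Φ))ᵀ := by
  ext τ h
  simp only [rtypeMatrix, ind_apply, mem_rmul, transpose_apply, leftMulMatrix_apply, coeff_qTypeOf]

/-- The rank of the right-translate matrix equals `cmRank Φ` (the left-translate rank). -/
theorem rank_rtypeMatrix (Φ : Finset G) : (rtypeMatrix Φ).rank = cmRank Φ := by
  rw [rtypeMatrix_eq_transpose, rank_transpose, cmRank_eq_rank_leftMulMatrix]

/-- The span of the indicators of the right translates `Φ τ` has dimension `cmRank Φ`. -/
theorem finrank_span_ind_rmul (Φ : Finset G) :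
    Module.finrank ℚ (Submodule.span ℚ (Set.range fun τ : G => ind (rmul Φ τ))) = cmRank Φ := by
  rw [← rank_rtypeMatrix, Matrix.rank_eq_finrank_span_row]
  rfl

end HodgeRepro.Hecke
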